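import Summits.MatrixMultiplication.MatrixMultiplication.Theses.DefinableSTPPDichotomy

/-!
# `PairwiseCurvedTilingsLC` (crux stmt-MatrixMultiplication-17883): pairwise packing, the mass
ceiling `|H|^{1+ε/3}`, and the uniform-`η` strengthening is FALSE

Negative-side lemmas from the refuter's crux attack (gen 2); elementary and sorry-free.

For a family `(A_x, B_x, C_x)_{x ∈ I}` of finite subsets of a finite abelian group `H` satisfying
the route's PAIRWISE STPP clause — the STPP relation for every label triple with at least two equal
entries, verbatim the clause of `PairwiseCurvedTilingsLC` and `HexagonClearanceR` — we prove:

* `card_mul_card_mul_card_le` — block TPP (pattern `i = j = k`): `(a, b, c) ↦ a + b + c` is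
  injective on `A_x × B_x × C_x`, so `|A_x||B_x||C_x| ≤ |H|`;
* `sum_card_AC_le`, `sum_card_AB_le`, `sum_card_BC_le` — the three colour-class PACKINGS over the
  blocks whose three sets are all nonempty (the others carry no mass): the patterns `i = j ≠ k`,
  `j = k ≠ i`, `k = i ≠ j`, with the repeated label's spare pair of elements taken equal, make
  `(x, a, c) ↦ a − c`, `(x, a, b) ↦ a − b`, `(x, b, c) ↦ b − c` injective, so
  `Σ|A_x||C_x|, Σ|A_x||B_x|, Σ|B_x||C_x| ≤ |H|` (BCCGNSU 2017 §2 packing bounds, which use only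
  these two-label patterns);
* `sum_rpow_le_card_rpow` — the MASS CEILING: for every `ε ≥ 0`,
  `Σ_{x ∈ I} (|A_x||B_x||C_x|)^{(2+ε)/3} ≤ |H|^{1+ε/3}`
  (AM–GM `(abc)^{2/3} ≤ (ab + bc + ca)/3` summed over the three packings, times
  `(abc)^{ε/3} ≤ |H|^{ε/3}` from block TPP);
* `eta_le` — hence every witness of the crux's mass bound `|F|^{m+η} ≤ Σ (abc)^{(2+ε)/3}` in `F^m`
  has `η ≤ m ε / 3`: the mass exponent gain is at most linear in `ε`, which is the counting that
  forces the tight `(d, d, d)` numerology recorded in the item's docstring;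
* `not_PairwiseCurvedTilingsLC_uniformEta` — consequently the natural strengthening of the crux
  with the two quantifiers swapped, `∃ η > 0, ∀ ε > 0` (one exponent gain serving every `ε`), is
  FALSE outright, for all formulas and all fields: the order `∀ ε, ∃ η` in the crux is load-bearing.

None of this refutes the crux — its content is the existence of the definable family in the tight
regime, a density statement with free constants — but it is the kernel-checked form of the counting
every analysis of the item (grounder, refuter gen 1/2, planner) starts from, reusable verbatim for
`HexagonClearanceR` (same hypothesis clause) and `TranslateFamiliesFail`.

References: J. Blasiak, T. Church, H. Cohn, J. A. Grochow, E. Naslund, W. F. Sawin, C. Umans,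
Discrete Analysis 2017:3 (arXiv:1605.06702) §2 (packing bounds); H. Cohn, R. Kleinberg, B. Szegedy,
C. Umans, FOCS 2005 (arXiv:math/0511460) Def. 5.1.
-/

set_option linter.dupNamespace false  -- `Summit.<S>.<S>.…` is the mandated namespace

namespace Summit.MatrixMultiplication.MatrixMultiplication.Theorems.PairwiseCurvedTilingsLC.Negative

open Finset

/-! ## AM–GM in the form used -/

/-- `(abc)^{2/3} ≤ (ab + bc + ca)/3` for non-negative reals: weighted AM–GM for the three numbers
`ab, bc, ca` with weights `1/3`, and `ab · bc · ca = (abc)²`. [folklore] -/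
theorem rpow_two_thirds_le {a b c : ℝ} (ha : 0 ≤ a) (hb : 0 ≤ b) (hc : 0 ≤ c) :
    (a * b * c) ^ ((2 : ℝ) / 3) ≤ (a * b + b * c + c * a) / 3 := by
  have h := Real.geom_mean_le_arith_mean3_weighted (w₁ := 1 / 3) (w₂ := 1 / 3) (w₃ := 1 / 3)
    (p₁ := a * b) (p₂ := b * c) (p₃ := c * a) (by norm_num) (by norm_num) (by norm_num)
    (mul_nonneg ha hb) (mul_nonneg hb hc) (mul_nonneg hc ha) (by norm_num)
  have hl : (a * b) ^ ((1 : ℝ) / 3) * (b * c) ^ ((1 : ℝ) / 3) * (c * a) ^ ((1 : ℝ) / 3) =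
      (a * b * c) ^ ((2 : ℝ) / 3) := by
    rw [← Real.mul_rpow (mul_nonneg ha hb) (mul_nonneg hb hc),
      ← Real.mul_rpow (mul_nonneg (mul_nonneg ha hb) (mul_nonneg hb hc)) (mul_nonneg hc ha)]
    have : a * b * (b * c) * (c * a) = (a * b * c) ^ ((2 : ℕ) : ℝ) := by
      rw [Real.rpow_natCast]; ring
    rw [this, ← Real.rpow_mul (mul_nonneg (mul_nonneg ha hb) hc)]
    norm_num
  rw [hl] at h
  linarith

/-! ## Block TPP and the three packings of a pairwise-STPP family -/

section Packing

variable {H : Type*} [AddCommGroup H] {ι : Type*} {I : Finset ι} {A B C : ι → Finset H}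
  (hP : ∀ i ∈ I, ∀ j ∈ I, ∀ k ∈ I, (i = j ∨ j = k ∨ k = i) →
    ∀ s ∈ A k, ∀ s' ∈ A i, ∀ t ∈ B i, ∀ t' ∈ B j, ∀ u ∈ C j, ∀ u' ∈ C k,
      (s' - s) + (t' - t) + (u' - u) = 0 → i = j ∧ j = k ∧ s = s' ∧ t = t' ∧ u = u')
include hP

/-- **Block TPP** (pattern `i = j = k` of the pairwise clause): `(a, b, c) ↦ a + b + c` is injective
on `A_x × B_x × C_x`, hence `|A_x||B_x||C_x| ≤ |H|` (CKSU 2005, abelian TPP volume bound).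
[folklore] -/
theorem card_mul_card_mul_card_le [Fintype H] {x : ι} (hx : x ∈ I) :
    (A x).card * (B x).card * (C x).card ≤ Fintype.card H := by
  have hinj : Set.InjOn (fun p : (H × H) × H => p.1.1 + p.1.2 + p.2) ↑((A x ×ˢ B x) ×ˢ C x) := by
    rintro ⟨⟨a, b⟩, c⟩ hp ⟨⟨a', b'⟩, c'⟩ hp' he
    simp only [mem_coe, mem_product] at hp hp'
    change a + b + c = a' + b' + c' at he
    have h0 : (a - a') + (b - b') + (c - c') = 0 := by
      have : (a - a') + (b - b') + (c - c') = (a + b + c) - (a' + b' + c') := by abel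
      rw [this, he, sub_self]
    obtain ⟨-, -, h1, h2, h3⟩ :=
      hP x hx x hx x hx (Or.inl rfl) a' hp'.1.1 a hp.1.1 b' hp'.1.2 b hp.1.2 c' hp'.2 c hp.2 h0
    subst h1 h2 h3
    rfl
  calc (A x).card * (B x).card * (C x).card = ((A x ×ˢ B x) ×ˢ C x).card := by
        simp only [card_product]
    _ ≤ (univ : Finset H).card := card_le_card_of_injOn _ (fun _ _ => mem_univ _) hinj
    _ = Fintype.card H := card_univ

/-- **Packing `A − C`** (pattern `i = j ≠ k` with `t = t'`): on the blocks with all three sets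
nonempty, `(x, a, c) ↦ a − c` is injective, so `Σ_x |A_x||C_x| ≤ |H|`.
[folklore; BCCGNSU 2017 §2 packing bound] -/
theorem sum_card_AC_le [Fintype H] :
    ∑ x ∈ I.filter (fun x => (A x).Nonempty ∧ (B x).Nonempty ∧ (C x).Nonempty),
      (A x).card * (C x).card ≤ Fintype.card H := by
  have hinj : Set.InjOn (fun p : (Σ _ : ι, H × H) => p.2.1 - p.2.2)
      ↑((I.filter (fun x => (A x).Nonempty ∧ (B x).Nonempty ∧ (C x).Nonempty)).sigma
        fun x => A x ×ˢ C x) := by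
    rintro ⟨x, a, c⟩ hp ⟨x', a', c'⟩ hp' he
    simp only [mem_coe, mem_sigma, mem_filter, mem_product] at hp hp'
    change a - c = a' - c' at he
    obtain ⟨⟨hx, -, ⟨b, hb⟩, -⟩, ha, hc⟩ := hp
    obtain ⟨⟨hx', -, -, -⟩, ha', hc'⟩ := hp'
    have h0 : (a - a') + (b - b) + (c' - c) = 0 := by
      have : (a - a') + (b - b) + (c' - c) = (a - c) - (a' - c') := by abel
      rw [this, he, sub_self]
    obtain ⟨-, h1, h2, -, h3⟩ :=
      hP x hx x hx x' hx' (Or.inl rfl) a' ha' a ha b hb b hb c hc c' hc' h0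
    subst h1 h2 h3
    rfl
  calc ∑ x ∈ I.filter (fun x => (A x).Nonempty ∧ (B x).Nonempty ∧ (C x).Nonempty),
        (A x).card * (C x).card
      = ((I.filter (fun x => (A x).Nonempty ∧ (B x).Nonempty ∧ (C x).Nonempty)).sigma
          fun x => A x ×ˢ C x).card := by
        rw [card_sigma]; simp only [card_product]
    _ ≤ (univ : Finset H).card := card_le_card_of_injOn _ (fun _ _ => mem_univ _) hinj
    _ = Fintype.card H := card_univ

/-- **Packing `A − B`** (pattern `j = k ≠ i` with `u = u'`): on the blocks with all three sets
nonempty, `(x, a, b) ↦ a − b` is injective, so `Σ_x |A_x||B_x| ≤ |H|`.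
[folklore; BCCGNSU 2017 §2 packing bound] -/
theorem sum_card_AB_le [Fintype H] :
    ∑ x ∈ I.filter (fun x => (A x).Nonempty ∧ (B x).Nonempty ∧ (C x).Nonempty),
      (A x).card * (B x).card ≤ Fintype.card H := by
  have hinj : Set.InjOn (fun p : (Σ _ : ι, H × H) => p.2.1 - p.2.2)
      ↑((I.filter (fun x => (A x).Nonempty ∧ (B x).Nonempty ∧ (C x).Nonempty)).sigma
        fun x => A x ×ˢ B x) := by
    rintro ⟨x, a, b⟩ hp ⟨x', a', b'⟩ hp' he
    simp only [mem_coe, mem_sigma, mem_filter, mem_product] at hp hp'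
    change a - b = a' - b' at he
    obtain ⟨⟨hx, -, -, -⟩, ha, hb⟩ := hp
    obtain ⟨⟨hx', -, -, ⟨c, hc⟩⟩, ha', hb'⟩ := hp'
    have h0 : (a - a') + (b' - b) + (c - c) = 0 := by
      have : (a - a') + (b' - b) + (c - c) = (a - b) - (a' - b') := by abel
      rw [this, he, sub_self]
    obtain ⟨h1, -, h2, h3, -⟩ :=
      hP x hx x' hx' x' hx' (Or.inr (Or.inl rfl)) a' ha' a ha b hb b' hb' c hc c hc h0
    subst h1 h2 h3
    rfl
  calc ∑ x ∈ I.filter (fun x => (A x).Nonempty ∧ (B x).Nonempty ∧ (C x).Nonempty),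
        (A x).card * (B x).card
      = ((I.filter (fun x => (A x).Nonempty ∧ (B x).Nonempty ∧ (C x).Nonempty)).sigma
          fun x => A x ×ˢ B x).card := by
        rw [card_sigma]; simp only [card_product]
    _ ≤ (univ : Finset H).card := card_le_card_of_injOn _ (fun _ _ => mem_univ _) hinj
    _ = Fintype.card H := card_univ

/-- **Packing `B − C`** (pattern `k = i ≠ j` with `s = s'`): on the blocks with all three sets
nonempty, `(x, b, c) ↦ b − c` is injective, so `Σ_x |B_x||C_x| ≤ |H|`.
[folklore; BCCGNSU 2017 §2 packing bound] -/
theorem sum_card_BC_le [Fintype H] :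
    ∑ x ∈ I.filter (fun x => (A x).Nonempty ∧ (B x).Nonempty ∧ (C x).Nonempty),
      (B x).card * (C x).card ≤ Fintype.card H := by
  have hinj : Set.InjOn (fun p : (Σ _ : ι, H × H) => p.2.1 - p.2.2)
      ↑((I.filter (fun x => (A x).Nonempty ∧ (B x).Nonempty ∧ (C x).Nonempty)).sigma
        fun x => B x ×ˢ C x) := by
    rintro ⟨x, b, c⟩ hp ⟨x', b', c'⟩ hp' he
    simp only [mem_coe, mem_sigma, mem_filter, mem_product] at hp hp'
    change b - c = b' - c' at he
    obtain ⟨⟨hx, -, -, -⟩, hb, hc⟩ := hp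
    obtain ⟨⟨hx', ⟨a, ha⟩, -, -⟩, hb', hc'⟩ := hp'
    have h0 : (a - a) + (b - b') + (c' - c) = 0 := by
      have : (a - a) + (b - b') + (c' - c) = (b - c) - (b' - c') := by abel
      rw [this, he, sub_self]
    obtain ⟨h1, -, -, h2, h3⟩ :=
      hP x' hx' x hx x' hx' (Or.inr (Or.inr rfl)) a ha a ha b' hb' b hb c hc c' hc' h0
    subst h1 h2 h3
    rfl
  calc ∑ x ∈ I.filter (fun x => (A x).Nonempty ∧ (B x).Nonempty ∧ (C x).Nonempty),
        (B x).card * (C x).card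
      = ((I.filter (fun x => (A x).Nonempty ∧ (B x).Nonempty ∧ (C x).Nonempty)).sigma
          fun x => B x ×ˢ C x).card := by
        rw [card_sigma]; simp only [card_product]
    _ ≤ (univ : Finset H).card := card_le_card_of_injOn _ (fun _ _ => mem_univ _) hinj
    _ = Fintype.card H := card_univ

/-- **Mass ceiling of a pairwise-STPP family.**  For every `ε ≥ 0`,
`Σ_{x ∈ I} (|A_x||B_x||C_x|)^{(2+ε)/3} ≤ |H|^{1+ε/3}`: blocks with an empty set carry no mass; on the
others `(abc)^{(2+ε)/3} = (abc)^{2/3} (abc)^{ε/3} ≤ ((ab+bc+ca)/3) · |H|^{ε/3}` by AM–GM and block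
TPP, and the three packings sum to `≤ 3|H|`.  In particular the `2/3`-mass of a pairwise-STPP
family never exceeds `|H|` (`ε = 0`). [folklore counting; BCCGNSU 2017 §2] -/
theorem sum_rpow_le_card_rpow [Fintype H] {ε : ℝ} (hε : 0 ≤ ε) :
    ∑ x ∈ I, (((A x).card * (B x).card * (C x).card : ℕ) : ℝ) ^ ((2 + ε) / 3) ≤
      (Fintype.card H : ℝ) ^ (1 + ε / 3) := by
  obtain ⟨I', hI'⟩ : ∃ I' : Finset ι,
      I' = I.filter (fun x => (A x).Nonempty ∧ (B x).Nonempty ∧ (C x).Nonempty) := ⟨_, rfl⟩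
  have hpack₁ : ∑ x ∈ I', (A x).card * (C x).card ≤ Fintype.card H := by
    rw [hI']; exact sum_card_AC_le hP
  have hpack₂ : ∑ x ∈ I', (A x).card * (B x).card ≤ Fintype.card H := by
    rw [hI']; exact sum_card_AB_le hP
  have hpack₃ : ∑ x ∈ I', (B x).card * (C x).card ≤ Fintype.card H := by
    rw [hI']; exact sum_card_BC_le hP
  set N : ℝ := (Fintype.card H : ℝ) with hN
  have hNpos : 0 < N := by rw [hN]; exact_mod_cast Fintype.card_pos
  have hexp : (0 : ℝ) < (2 + ε) / 3 := by linarith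
  have hp₁ : ∑ x ∈ I', ((A x).card : ℝ) * (C x).card ≤ N := by rw [hN]; exact_mod_cast hpack₁
  have hp₂ : ∑ x ∈ I', ((A x).card : ℝ) * (B x).card ≤ N := by rw [hN]; exact_mod_cast hpack₂
  have hp₃ : ∑ x ∈ I', ((B x).card : ℝ) * (C x).card ≤ N := by rw [hN]; exact_mod_cast hpack₃
  have hp₁' : ∑ x ∈ I', ((C x).card : ℝ) * (A x).card ≤ N := by
    calc ∑ x ∈ I', ((C x).card : ℝ) * (A x).card = ∑ x ∈ I', ((A x).card : ℝ) * (C x).card :=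
          Finset.sum_congr rfl (fun x _ => mul_comm _ _)
      _ ≤ N := hp₁
  push_cast
  -- only the blocks in `I'` carry mass
  have hsum : ∑ x ∈ I, (((A x).card : ℝ) * (B x).card * (C x).card) ^ ((2 + ε) / 3) =
      ∑ x ∈ I', (((A x).card : ℝ) * (B x).card * (C x).card) ^ ((2 + ε) / 3) := by
    symm
    rw [hI']
    apply Finset.sum_subset (filter_subset _ _)
    intro x hxI hxI'
    have h0 : ((A x).card : ℝ) * (B x).card * (C x).card = 0 := by
      simp only [mem_filter, not_and_or, not_nonempty_iff_eq_empty] at hxI'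
      rcases hxI' with h | h | h | h
      · exact absurd hxI h
      all_goals simp [h]
    rw [h0, Real.zero_rpow hexp.ne']
  -- termwise: AM–GM times the block-TPP bound
  have hterm : ∀ x ∈ I', (((A x).card : ℝ) * (B x).card * (C x).card) ^ ((2 + ε) / 3) ≤
      (((A x).card : ℝ) * (B x).card + ((B x).card : ℝ) * (C x).card +
        ((C x).card : ℝ) * (A x).card) / 3 * N ^ (ε / 3) := by
    intro x hx
    have hxI : x ∈ I := by rw [hI'] at hx; exact (mem_filter.1 hx).1
    have ha : (0 : ℝ) ≤ (A x).card := Nat.cast_nonneg _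
    have hb : (0 : ℝ) ≤ (B x).card := Nat.cast_nonneg _
    have hc : (0 : ℝ) ≤ (C x).card := Nat.cast_nonneg _
    have hw0 : (0 : ℝ) ≤ ((A x).card : ℝ) * (B x).card * (C x).card := by positivity
    have hwN : ((A x).card : ℝ) * (B x).card * (C x).card ≤ N := by
      rw [hN]; exact_mod_cast card_mul_card_mul_card_le hP hxI
    rw [show (2 + ε) / 3 = (2 : ℝ) / 3 + ε / 3 by ring,
      Real.rpow_add' hw0 (ne_of_gt (by linarith))]
    exact mul_le_mul (rpow_two_thirds_le ha hb hc) (Real.rpow_le_rpow hw0 hwN (by linarith))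
      (by positivity) (by positivity)
  rw [hsum]
  calc ∑ x ∈ I', (((A x).card : ℝ) * (B x).card * (C x).card) ^ ((2 + ε) / 3)
      ≤ ∑ x ∈ I', (((A x).card : ℝ) * (B x).card + ((B x).card : ℝ) * (C x).card +
          ((C x).card : ℝ) * (A x).card) / 3 * N ^ (ε / 3) := Finset.sum_le_sum hterm
    _ = ((∑ x ∈ I', ((A x).card : ℝ) * (B x).card) + (∑ x ∈ I', ((B x).card : ℝ) * (C x).card) +
          (∑ x ∈ I', ((C x).card : ℝ) * (A x).card)) / 3 * N ^ (ε / 3) := by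
        rw [← Finset.sum_mul, ← Finset.sum_div, Finset.sum_add_distrib, Finset.sum_add_distrib]
    _ ≤ (N + N + N) / 3 * N ^ (ε / 3) := by gcongr
    _ = N ^ (1 + ε / 3) := by
        rw [Real.rpow_add hNpos, Real.rpow_one]; ring

end Packing

/-! ## Consequences for the crux -/

/-- **The exponent gain is at most linear in `ε`.**  If a family in `F^m` (any finite field `F`, any
index set, definable or not) satisfies the pairwise STPP clause of `PairwiseCurvedTilingsLC` and its
mass bound `|F|^{m+η} ≤ Σ_x (|A_x||B_x||C_x|)^{(2+ε)/3}` for some `ε ≥ 0`, then `η ≤ m ε / 3`.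
(`sum_rpow_le_card_rpow` in `H = F^m`, `|F^m| = |F|^m`, `|F| ≥ 2`.) -/
theorem eta_le {F : Type*} [Field F] [Fintype F] {e m : ℕ} {I : Finset (Fin e → F)}
    {A B C : (Fin e → F) → Finset (Fin m → F)}
    (hP : ∀ i ∈ I, ∀ j ∈ I, ∀ k ∈ I, (i = j ∨ j = k ∨ k = i) →
      ∀ s ∈ A k, ∀ s' ∈ A i, ∀ t ∈ B i, ∀ t' ∈ B j, ∀ u ∈ C j, ∀ u' ∈ C k,
        (s' - s) + (t' - t) + (u' - u) = 0 → i = j ∧ j = k ∧ s = s' ∧ t = t' ∧ u = u')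
    {ε η : ℝ} (hε : 0 ≤ ε)
    (hmass : (Fintype.card F : ℝ) ^ ((m : ℝ) + η) ≤
      ∑ x ∈ I, (((A x).card * (B x).card * (C x).card : ℕ) : ℝ) ^ ((2 + ε) / 3)) :
    η ≤ m * ε / 3 := by
  have hle := sum_rpow_le_card_rpow (H := Fin m → F) hP hε
  have hcard : (Fintype.card (Fin m → F) : ℝ) = (Fintype.card F : ℝ) ^ (m : ℝ) := by
    rw [Real.rpow_natCast, Fintype.card_fun, Fintype.card_fin]
    push_cast
    rfl
  rw [hcard, ← Real.rpow_mul (Nat.cast_nonneg _)] at hle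
  have hq : (1 : ℝ) < Fintype.card F := by exact_mod_cast Fintype.one_lt_card
  have h1 := (Real.rpow_le_rpow_left_iff hq).1 (hmass.trans hle)
  have h2 : (m : ℝ) * (1 + ε / 3) = m + m * ε / 3 := by ring
  linarith

/-- **The uniform-`η` strengthening of the crux is false.**  `PairwiseCurvedTilingsLC` asks, for
fixed formulas, `∀ ε > 0, ∃ η > 0, …`.  Swapping the quantifiers — one exponent gain `η > 0` that
serves every `ε > 0` — is refuted by counting alone, whatever the formulas, parameters and fields:
at `ε := η/(m+1)` any witness would have `η ≤ m ε / 3 < η` (`eta_le`).  So the dependence of `η` on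
`ε` in the crux is load-bearing (necessarily `η ≤ m ε / 3`), not a cosmetic choice of the planner.
-/
theorem not_PairwiseCurvedTilingsLC_uniformEta :
    ¬ ∃ (e m k : ℕ) (φI : FirstOrder.Language.ring.Formula (Fin e ⊕ Fin k))
        (φA φB φC : FirstOrder.Language.ring.Formula ((Fin e ⊕ Fin m) ⊕ Fin k)),
        ∃ η : ℝ, 0 < η ∧ ∀ ε : ℝ, 0 < ε → ∀ q₀ : ℕ, ∃ (F : Type) (_ : Field F) (_ : Fintype F)
          (_ : FirstOrder.Ring.CompatibleRing F), q₀ ≤ ringChar F ∧ ∃ (y : Fin k → F)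
          (I : Finset (Fin e → F)) (A B C : (Fin e → F) → Finset (Fin m → F)),
          (∀ x, x ∈ I ↔ φI.Realize (Sum.elim x y)) ∧
          (∀ x v, v ∈ A x ↔ φA.Realize (Sum.elim (Sum.elim x v) y)) ∧
          (∀ x v, v ∈ B x ↔ φB.Realize (Sum.elim (Sum.elim x v) y)) ∧
          (∀ x v, v ∈ C x ↔ φC.Realize (Sum.elim (Sum.elim x v) y)) ∧
          (∀ i ∈ I, ∀ j ∈ I, ∀ k ∈ I, (i = j ∨ j = k ∨ k = i) → ∀ s ∈ A k, ∀ s' ∈ A i,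
            ∀ t ∈ B i, ∀ t' ∈ B j, ∀ u ∈ C j, ∀ u' ∈ C k,
            (s' - s) + (t' - t) + (u' - u) = 0 → i = j ∧ j = k ∧ s = s' ∧ t = t' ∧ u = u') ∧
          (Fintype.card F : ℝ) ^ ((m : ℝ) + η) ≤
            ∑ x ∈ I, (((A x).card * (B x).card * (C x).card : ℕ) : ℝ) ^ ((2 + ε) / 3) := by
  rintro ⟨e, m, k, φI, φA, φB, φC, η, hη, h⟩
  have hm0 : (0 : ℝ) ≤ m := Nat.cast_nonneg _
  have hm1 : (0 : ℝ) < m + 1 := by linarith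
  obtain ⟨F, _, _, _, -, y, I, A, B, C, -, -, -, -, hP, hmass⟩ :=
    h (η / (m + 1)) (div_pos hη hm1) 0
  have key := eta_le hP (div_pos hη hm1).le hmass
  have hlt : (m : ℝ) * (η / (m + 1)) / 3 < η := by
    rw [mul_div_assoc', div_div, div_lt_iff₀ (by positivity)]
    nlinarith [mul_nonneg hm0 hη.le]
  linarith

end Summit.MatrixMultiplication.MatrixMultiplication.Theorems.PairwiseCurvedTilingsLC.Negative
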